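import Summits.Ventures.YMGap.Census.ZplusLowerBound
import HarnessLib

/-!
# Venture YMGap, track (b) — the interpolation ray `α ↦ Z⁻_Λ({α c})/Z_Λ({α c})` is continuous, starts at `1`, and takes
# every value between its endpoint values: Tomboulis's V.1 / Ito–Seiler's Claim 2.1 existence of `α*` from the lower bound
# (5.22) by the intermediate value theorem

HONEST FRAMING: venture file of the cell `pub-ymgap` (QuantumFields programme), track (b); finite even tori `(ℤ/Lℤ)^d`, `d ≥ 3`;
nothing about Tomboulis's (5.15), limits, confinement or a mass gap; nothing is claimed about whether a (5.22) instance holds.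

Tomboulis, arXiv:0707.2179, Prop. V.1 (eqs. (5.17)–(5.18)) obtains a COMMON interpolation parameter `α*` with
`Z⁻_Λ/Z_Λ = Z⁻_{Λ^{(n)}}({c̃_j(n,α*)})/Z_{Λ^{(n)}}({c̃_j(n,α*)})` from the disputed (5.15)/(5.16) via App. C; Ito–Seiler
(arXiv:0711.4930 Claim 2.1, (2.4): "`α = α(t) ∈ [0,1]` is chosen so that the above relation becomes exact") dispute the
existence.  The tree's `TomboulisVortexDecimation` records (docstring of `CommonInterpolation`): "Given IV.1 and continuity this
follows from `MKTLowerBound` by the intermediate value theorem".  This file makes that remark a kernel theorem: on the even torus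
`(ℤ/Lℤ)^d`, `d ≥ 3`, for every spin cut-off and admissible `c'`, the ray `g(α) = Z⁻({α c'})/Z({α c'})` (twist on `𝒱_{ij}`) is
continuous on `[0,1]` with `g(0) = 1` (`Z({0}) = Z⁻({0}) = 1`), so every `y` with `g(1) ≤ y ≤ 1` is attained at some
`α ∈ [0,1]` (`exists_vortexRatio_scaleCoeff_eq`); in particular a (5.22) instance (the census item C6, tree `Prop`
`MKTLowerBound`) together with IV.1 on the fine torus (`CharacterTwistBound.twistLe_vortexSheet_plane`) yields the common
`α* ∈ [0,1]` (`exists_common_alpha_of_ratio_le`) — with the CLOSED interval of Ito–Seiler's phrasing; the open interval of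
`CommonInterpolation` would need the strict forms of IV.1 and (5.22).

## Main statements (namespace `Summit.Ventures.YMGap.Census`)

* `continuous_torusZ_scaleCoeff`, `continuous_torusZtw_scaleCoeff`, `torusZ_scaleCoeff_zero`, `torusZtw_scaleCoeff_zero`.
* `continuousOn_vortexRatio_scaleCoeff` — `3 ≤ d`, `L` even, admissible `c'`: `α ↦ Z⁻/Z({α c'})` is continuous on `[0,1]`.
* **`exists_vortexRatio_scaleCoeff_eq`** — every `y ∈ [Z⁻/Z({c'}), 1]` is `Z⁻/Z({α c'})` for some `α ∈ [0,1]`.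
* `exists_common_alpha_of_ratio_le` — fine torus `(ℤ/L'ℤ)^d` (`L'` even), coarse torus `(ℤ/Lℤ)^d` (`L` even), same plane:
  `Z⁻/Z_coarse({c'}) ≤ Z⁻/Z_fine({c})` ⟹ `∃ α ∈ [0,1]`, `Z⁻/Z_fine({c}) = Z⁻/Z_coarse({α c'})`.
* `torusZ_scaleCoeff_monotoneOn`, `torusZplus_scaleCoeff_monotoneOn` — Props. III.3 (3.21) / IV.5 (4.16) in weak form: `Z` and
  `Z⁺` are non-decreasing along the ray (even torus, every `J`).

References: E. T. Tomboulis, arXiv:0707.2179, Prop. V.1 eqs. (5.17)–(5.18), Prop. V.2 eq. (5.22) [cite: Tomboulis2007Confinement,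
Props. V.1–V.2]; K. R. Ito, E. Seiler, arXiv:0711.4930, §2 Claim 2.1, eq. (2.4) [cite: ItoSeiler2007Tomboulis, §2 Claim 2.1].
-/

noncomputable section

open MeasureTheory Finset Real
open scoped BigOperators
open Literature.MathematicalPhysics.QuantumLattice
open Literature.MathematicalPhysics.QuantumFieldTheory
open Literature.MathematicalPhysics.QuantumFieldTheory.Tomboulis2007
open Literature.MathematicalPhysics.QuantumFieldTheory.WilsonRP

namespace Summit.Ventures.YMGap.Census

variable {d L : ℕ}

/-! ### The ray as an affine line of fields; continuity; value at `α = 0` -/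

section Ray

variable [NeZero L]

omit [NeZero L] in
/-- The uniform field of the ray: `stdCoef (α c) = oneCoef + α · gCoef c` at every plaquette. -/
theorem stdCoef_scaleCoeff_field (c : ℕ → ℝ) (α : ℝ) :
    (fun _ : Plaquette d L => stdCoef (scaleCoeff α c)) =
      fun (_ : Plaquette d L) (n : ℕ) => oneCoef n + α * gCoef c n := by
  funext p n
  exact stdCoef_scaleCoeff_eq c α n

/-- `Z_Λ({α c})` as a field partition function on the line `oneCoef + α gCoef`. -/
theorem torusZ_scaleCoeff_eq_line (J : ℕ) (c : ℕ → ℝ) (α : ℝ) :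
    torusZ d L J (scaleCoeff α c) =
      coefFieldZ J (fun (_ : Plaquette d L) (n : ℕ) => oneCoef n + α * gCoef c n) := by
  rw [torusZ_eq_coefFieldZ, stdCoef_scaleCoeff_field]

/-- `Z⁻_Λ({α c})` as a field partition function on the twisted line. -/
theorem torusZtw_scaleCoeff_eq_line (J : ℕ) (c : ℕ → ℝ) (α : ℝ) (V : Finset (Plaquette d L)) :
    torusZtw d L J (scaleCoeff α c) V =
      coefFieldZ J (fun p n => twistField V (fun _ : Plaquette d L => oneCoef) p n +
        α * twistField V (fun _ : Plaquette d L => gCoef c) p n) := by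
  rw [torusZtw_eq_coefFieldZ_twistField, stdCoef_scaleCoeff_field, twistField_line]

variable [NeZero d] [Fact (1 < L)]

omit [NeZero d] [Fact (1 < L)] in
/-- **`α ↦ Z_Λ({α c})` is continuous** (it is differentiable: `TwistFieldLine.hasDerivAt_coefFieldZ_line`). -/
theorem continuous_torusZ_scaleCoeff (J : ℕ) (c : ℕ → ℝ) : Continuous fun α : ℝ => torusZ d L J (scaleCoeff α c) := by
  have h : (fun α : ℝ => torusZ d L J (scaleCoeff α c)) =
      fun α => coefFieldZ J (fun (_ : Plaquette d L) (n : ℕ) => oneCoef n + α * gCoef c n) :=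
    funext fun α => torusZ_scaleCoeff_eq_line J c α
  rw [h]
  exact continuous_iff_continuousAt.2 fun α =>
    (hasDerivAt_coefFieldZ_line J (fun _ : Plaquette d L => oneCoef) (fun _ : Plaquette d L => gCoef c) α).continuousAt

omit [NeZero d] [Fact (1 < L)] in
/-- **`α ↦ Z⁻_Λ({α c})` is continuous.** -/
theorem continuous_torusZtw_scaleCoeff (J : ℕ) (c : ℕ → ℝ) (V : Finset (Plaquette d L)) :
    Continuous fun α : ℝ => torusZtw d L J (scaleCoeff α c) V := by
  have h : (fun α : ℝ => torusZtw d L J (scaleCoeff α c) V) =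
      fun α => coefFieldZ J (fun p n => twistField V (fun _ : Plaquette d L => oneCoef) p n +
        α * twistField V (fun _ : Plaquette d L => gCoef c) p n) :=
    funext fun α => torusZtw_scaleCoeff_eq_line J c α V
  rw [h]
  exact continuous_iff_continuousAt.2 fun α =>
    (hasDerivAt_coefFieldZ_line J (twistField V fun _ : Plaquette d L => oneCoef)
      (twistField V fun _ : Plaquette d L => gCoef c) α).continuousAt

omit [NeZero d] [Fact (1 < L)] in
/-- The partition function of the trivial weight is `1`. -/
theorem coefFieldZ_oneCoef (J : ℕ) : coefFieldZ J (fun _ : Plaquette d L => oneCoef) = 1 := by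
  unfold coefFieldZ coefFieldFn
  simp [charSum_oneCoef]

omit [NeZero d] [NeZero L] [Fact (1 < L)] in
/-- Twisting the trivial weight does nothing (it has no half-integer part). -/
theorem twistField_oneCoef (V : Finset (Plaquette d L)) :
    twistField V (fun _ : Plaquette d L => oneCoef) = fun _ : Plaquette d L => oneCoef := by
  funext p
  by_cases hp : p ∈ V
  · rw [twistField_of_mem hp]
    funext n
    unfold twistVec oneCoef
    split_ifs with hn
    · subst hn; simp
    · simp
  · rw [twistField_of_not_mem hp]

omit [NeZero d] [Fact (1 < L)] in
/-- `Z_Λ({0}) = 1`. -/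
theorem torusZ_scaleCoeff_zero (J : ℕ) (c : ℕ → ℝ) : torusZ d L J (scaleCoeff 0 c) = 1 := by
  rw [torusZ_eq_coefFieldZ, stdCoef_scaleCoeff_zero, coefFieldZ_oneCoef]

omit [NeZero d] [Fact (1 < L)] in
/-- `Z⁻_Λ({0}) = 1`. -/
theorem torusZtw_scaleCoeff_zero (J : ℕ) (c : ℕ → ℝ) (V : Finset (Plaquette d L)) :
    torusZtw d L J (scaleCoeff 0 c) V = 1 := by
  rw [torusZtw_eq_coefFieldZ_twistField, stdCoef_scaleCoeff_zero, twistField_oneCoef, coefFieldZ_oneCoef]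

end Ray

/-! ### The vortex free-energy ratio along the ray: continuity and the intermediate value theorem -/

/-- Along the ray from an admissible vector the coefficients stay admissible. -/
theorem coeffAdmissible_scaleCoeff {c : ℕ → ℝ} (hc : CoeffAdmissible c) {α : ℝ} (hα : α ∈ Set.Icc (0 : ℝ) 1) :
    CoeffAdmissible (scaleCoeff α c) := fun n hn =>
  ⟨mul_nonneg hα.1 (hc n hn).1, by
    calc α * c n ≤ 1 * 1 := mul_le_mul hα.2 (hc n hn).2 (hc n hn).1 zero_le_one
      _ = 1 := one_mul 1⟩

/-- **The ratio `α ↦ Z⁻_Λ({α c})/Z_Λ({α c})` is continuous on `[0,1]`** (`d ≥ 3`, `L` even, admissible `c`: the denominator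
is `≥ 1` there by `one_le_torusZ_even`). -/
theorem continuousOn_vortexRatio_scaleCoeff (hd : 3 ≤ d) [NeZero L] (hL : Even L) (J : ℕ) {c : ℕ → ℝ}
    (hc : CoeffAdmissible c) (V : Finset (Plaquette d L)) :
    ContinuousOn (fun α : ℝ => vortexRatio d L J (scaleCoeff α c) V) (Set.Icc 0 1) := by
  unfold vortexRatio
  refine ContinuousOn.div (continuous_torusZtw_scaleCoeff J c V).continuousOn
    (continuous_torusZ_scaleCoeff J c).continuousOn fun α hα => ?_
  exact (zero_lt_one.trans_le (one_le_torusZ_even hd hL J (coeffAdmissible_scaleCoeff hc hα))).ne'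

/-- At `α = 0` the ratio is `1`. -/
theorem vortexRatio_scaleCoeff_zero [NeZero L] (J : ℕ) (c : ℕ → ℝ) (V : Finset (Plaquette d L)) :
    vortexRatio d L J (scaleCoeff 0 c) V = 1 := by
  unfold vortexRatio
  rw [torusZ_scaleCoeff_zero, torusZtw_scaleCoeff_zero, div_one]

/-- **Intermediate value theorem along the ray**: on the even torus `(ℤ/Lℤ)^d`, `d ≥ 3`, for every spin cut-off, twist set and
admissible `c`, every `y` with `Z⁻/Z({c}) ≤ y ≤ 1` equals `Z⁻/Z({α c})` for some `α ∈ [0,1]`. -/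
theorem exists_vortexRatio_scaleCoeff_eq (hd : 3 ≤ d) [NeZero L] (hL : Even L) (J : ℕ) {c : ℕ → ℝ} (hc : CoeffAdmissible c)
    (V : Finset (Plaquette d L)) {y : ℝ} (hy₁ : vortexRatio d L J c V ≤ y) (hy₂ : y ≤ 1) :
    ∃ α ∈ Set.Icc (0 : ℝ) 1, vortexRatio d L J (scaleCoeff α c) V = y := by
  have hcont := continuousOn_vortexRatio_scaleCoeff hd hL J hc V
  have hivt := intermediate_value_Icc' (zero_le_one' ℝ) hcont
  have hy : y ∈ Set.Icc (vortexRatio d L J (scaleCoeff 1 c) V) (vortexRatio d L J (scaleCoeff 0 c) V) := by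
    rw [scaleCoeff_one, vortexRatio_scaleCoeff_zero]
    exact ⟨hy₁, hy₂⟩
  obtain ⟨α, hα, hαy⟩ := hivt hy
  exact ⟨α, hα, hαy⟩

/-- **A common interpolation parameter from the lower bound** (Tomboulis's V.1 (5.17) from V.2 (5.22) + IV.1 + continuity;
Ito–Seiler's Claim 2.1 with `α ∈ [0,1]`): for a fine even torus `(ℤ/L'ℤ)^d` and a coarse even torus `(ℤ/Lℤ)^d` (`d ≥ 3`), spin
cut-offs `J'`, `J`, admissible `c` (fine) and `c'` (coarse) and the vortex sheets of the same plane, IF the coarse ratio at `c'`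
bounds the fine ratio from below (a (5.22) instance), THEN some `α ∈ [0,1]` on the ray to `c'` reproduces the fine ratio exactly. -/
theorem exists_common_alpha_of_ratio_le (hd : 3 ≤ d) {L' : ℕ} [NeZero L'] [NeZero L] (hL' : Even L') (hL : Even L)
    (J' J : ℕ) {i j : Fin d} (hij : i < j) {c c' : ℕ → ℝ} (hc : CoeffAdmissible c) (hc' : CoeffAdmissible c')
    (hle : vortexRatio d L J c' (vortexSheet L i j hij) ≤ vortexRatio d L' J' c (vortexSheet L' i j hij)) :
    ∃ α ∈ Set.Icc (0 : ℝ) 1,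
      vortexRatio d L' J' c (vortexSheet L' i j hij) = vortexRatio d L J (scaleCoeff α c') (vortexSheet L i j hij) := by
  haveI : NeZero d := ⟨by omega⟩
  have hL1 : 1 < L' := by
    have h0 : L' ≠ 0 := NeZero.ne L'
    obtain ⟨m, hm⟩ := hL'
    omega
  haveI : Fact (1 < L') := ⟨hL1⟩
  have h01 : (0 : Fin d) < 1 := by
    rw [Fin.lt_def, Fin.val_zero, Fin.val_one', Nat.one_mod_eq_one.mpr (by omega)]
    exact Nat.one_pos
  -- IV.1 on the fine torus: the fine ratio is `≤ 1`
  have hZ : 1 ≤ torusZ d L' J' c := one_le_torusZ_even hd hL' J' hc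
  have hle1 : vortexRatio d L' J' c (vortexSheet L' i j hij) ≤ 1 := by
    unfold vortexRatio
    rw [div_le_one (zero_lt_one.trans_le hZ)]
    exact twistLe_vortexSheet_plane hL' h01 J' hij c hc
  obtain ⟨α, hα, h⟩ := exists_vortexRatio_scaleCoeff_eq hd hL J hc' (vortexSheet L i j hij) hle hle1
  exact ⟨α, hα, h.symm⟩

/-! ### III.3 (3.21) and IV.5 (4.16) in weak form: `Z` and `Z⁺` are non-decreasing along the ray -/

section RayMono

variable [NeZero d] [NeZero L] [Fact (1 < L)]

omit [NeZero d] [NeZero L] [Fact (1 < L)] in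
/-- The part of `c` seen by the spin cut-off: `c_n` for `n ≥ 1`, `0` at `n = 0` (the plaquette function ignores `c_0`). -/
theorem scaleCoeff_trunc_le {c : ℕ → ℝ} (hc : CoeffAdmissible c) {a b : ℝ} (hab : a ≤ b) (n : ℕ) :
    scaleCoeff a (fun m => if 1 ≤ m then c m else 0) n ≤ scaleCoeff b (fun m => if 1 ≤ m then c m else 0) n := by
  unfold scaleCoeff
  by_cases hn : 1 ≤ n
  · simp only [hn, if_true]
    exact mul_le_mul_of_nonneg_right hab (hc n hn).1
  · simp [hn]

omit [NeZero d] [NeZero L] [Fact (1 < L)] in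
/-- The truncated vector is admissible along the ray. -/
theorem coeffAdmissible_scaleCoeff_trunc {c : ℕ → ℝ} (hc : CoeffAdmissible c) {a : ℝ} (ha : a ∈ Set.Icc (0 : ℝ) 1) :
    CoeffAdmissible (scaleCoeff a fun m => if 1 ≤ m then c m else 0) := by
  refine coeffAdmissible_scaleCoeff (fun n hn => ?_) ha
  simp only [hn, if_true]
  exact hc n hn

omit [NeZero d] [Fact (1 < L)] in
/-- `Z_Λ({α c})` only sees `c_1, …, c_J`. -/
theorem torusZ_scaleCoeff_trunc (J : ℕ) (c : ℕ → ℝ) (t : ℝ) :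
    torusZ d L J (scaleCoeff t c) = torusZ d L J (scaleCoeff t fun m => if 1 ≤ m then c m else 0) :=
  torusZ_congr J fun n hn => by simp [scaleCoeff, (Finset.mem_Icc.1 hn).1]

omit [NeZero d] [Fact (1 < L)] in
/-- `Z⁻_Λ({α c})` only sees `c_1, …, c_J`. -/
theorem torusZtw_scaleCoeff_trunc (J : ℕ) (c : ℕ → ℝ) (t : ℝ) (V : Finset (Plaquette d L)) :
    torusZtw d L J (scaleCoeff t c) V = torusZtw d L J (scaleCoeff t fun m => if 1 ≤ m then c m else 0) V :=
  torusZtw_congr J (fun n hn => by simp [scaleCoeff, (Finset.mem_Icc.1 hn).1]) V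

/-- **Prop. III.3 (arXiv:0707.2179 eq. (3.21)), weak form along the ray with `c^L = 0`**: on the even torus, for every spin
cut-off and admissible `c`, `α ↦ Z_Λ({α c})` is non-decreasing on `[0, 1]` (from II.1 (i), `CoeffMonotone.coeffMonotone`). -/
theorem torusZ_scaleCoeff_monotoneOn (hL : Even L) (J : ℕ) {c : ℕ → ℝ} (hc : CoeffAdmissible c) :
    MonotoneOn (fun α : ℝ => torusZ d L J (scaleCoeff α c)) (Set.Icc 0 1) := by
  intro a ha b hb hab
  simp only
  rw [torusZ_scaleCoeff_trunc J c a, torusZ_scaleCoeff_trunc J c b]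
  exact coeffMonotone hL J _ _ (coeffAdmissible_scaleCoeff_trunc hc ha) (coeffAdmissible_scaleCoeff_trunc hc hb)
    (scaleCoeff_trunc_le hc hab)

omit [NeZero d] [Fact (1 < L)] in
/-- **Prop. IV.5 (arXiv:0707.2179 eq. (4.16)), weak form along the ray with `c^L = 0`**: on the even torus, for every spin
cut-off, every plane and admissible `c`, `α ↦ Z⁺_Λ({α c})` is non-decreasing on `[0, 1]` (from IV.2 (i), `torusZplus_mono`). -/
theorem torusZplus_scaleCoeff_monotoneOn (hL : Even L) (J : ℕ) {i j : Fin d} (hij : i < j) {c : ℕ → ℝ}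
    (hc : CoeffAdmissible c) :
    MonotoneOn (fun α : ℝ => torusZplus d L J (scaleCoeff α c) (vortexSheet L i j hij)) (Set.Icc 0 1) := by
  intro a ha b hb hab
  simp only
  unfold torusZplus
  rw [torusZ_scaleCoeff_trunc J c a, torusZ_scaleCoeff_trunc J c b, torusZtw_scaleCoeff_trunc J c a,
    torusZtw_scaleCoeff_trunc J c b]
  have h := torusZplus_mono hL J hij (coeffAdmissible_scaleCoeff_trunc hc ha) (coeffAdmissible_scaleCoeff_trunc hc hb)
    (scaleCoeff_trunc_le hc hab)
  unfold torusZplus at h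
  exact h

end RayMono

end Summit.Ventures.YMGap.Census

end
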